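import Summits.BirchSwinnertonDyer.Rank1Residual.X2.ResidualLineCharacters
import Literature.NumberTheory.EllipticCurves.WeilPairingProofs
import Literature.NumberTheory.EllipticCurves.GreenbergVatsal2000.CharacterInvariantsTwisted
import Literature.NumberTheory.EllipticCurves.GreenbergVatsal2000.CharacterInvariantsTwistedProofs
import HarnessLib

/-!
# X3 (additive, `E[p]` reducible): the EVALUATION `hn` of Greenberg–Vatsal's residual count
# `#H¹(ℚ_Σ/ℚ_∞, Φ₀) · #U(W[p]/Φ₀)` at an even, non-degenerate rational line from the CHARACTER facts of
# GV pp. 41–42 at a twist + two per-pair `λ`-certificates of Kubota–Leopoldt `L`-functions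
# (cell `bsd-eis`, seat `bsd-eis-x3` gen 3; route K1 `AdditiveBranchIMC` — supports only)

HONEST FRAMING (cell `bsd-eis`, `run/shared/lean/pub/bsd-eis/README.md` §4): the programme's target
of record is the full Birch–Swinnerton-Dyer formula for every `E/ℚ` of analytic rank `≤ 1`; this file
is a TOOL for the X3 rows (an odd prime `p` of additive potentially ordinary reduction with `E[p]`
reducible). THEOREMS ONLY (no `def`, no named fact, no `sorry`); nothing is booked by this file.

## What and why

On the seat's CERTIFICATE ROAD (`X3BranchCertificateRoad[Mult|Gord].lean`, gen 2) and on its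
DEGENERATE road (`X3BranchDegenerate*.lean`) the only displayed per-pair input that is NOT an
instrument datum was the EVALUATION `hn : p^{n + Σ_{v∈Σ₀} δ_v(W)} = #residualLineH1 · #residualQuotSelmer`
of GV's residual count (GV §2 (16), Props. (2.6)/(2.8), Cor. (2.3) with Ferrero–Washington and
Mazur–Wiles: `#H¹(ℚ_Σ/ℚ_∞, Φ₀) = p^{λ(L_{Σ₀}(C ⊗ χ, T))}`, `#U = p^{λ(L_{Σ₀}(D ⊗ χ, T))}`). On the X3
rows the residual characters are `φ_E = χφ_V` (even; UNRAMIFIED at `p` when `p = 3`) and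
`ψ_E = χψ_V` (odd; RAMIFIED at `p` through `χ|I_p = ω^{(p−1)/2}`), so the tree's `χ = 1` character
facts (`CharacterInvariants.lean`: `φ` ramified, `ψ` unramified at `p`) do not apply; GV print the
same sentences at the twist `χ` (pp. 41–42, `K` "tamely ramified at `p`"), now filed as
`characterLFunctionC_hasUnitContent_and_order_eq_card_of_ne_one` /
`characterLFunctionD_hasUnitContent_and_order_eq_card_of_ne_teichmuller`
(`CharacterInvariantsTwisted.lean`, with the Kubota–Leopoldt existence PROVED in
`CharacterInvariantsTwistedProofs.lean`). THIS FILE turns them into `hn`: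

* §1 `exists_mem_of_dvd_level_quot_of_ne` — the primes `ℓ ≠ p` of the conductor of `ψ` lie in `Σ₀`
  (Néron–Ogg–Shafarevich; X2's `exists_mem_of_dvd_level_quot` without its `p ∤ d`);
  `natCast_val_modNCyclotomicCharacter_of_dvd` (`χ_M ≡ χ_n (mod n)` for `n ∣ M`);
  `character_sub_ne_one_of_exists_smul_ne` (`φ ≠ 1` from a point of `Φ₀` moved by `Γ_ℚ`);
  `natCast_mul_eq_modNCyclotomicCharacter_of_line` (**`φψ = χ_p`**, GV p. 28 "`φψ = ω`", from the
  tree's PROVED Weil pairing `exists_weilPairing_holds`) and hence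
  `exists_coprime_apply_ne_of_exists_smul_ne` (`ψ ≠ ω`: an integer `c` prime to `dp` with
  `ψ(c) ≢ c (mod p)`, from the SAME non-triviality of `Φ₀` — no extra line datum).
* §2 **`X3Branch.residualCount_eq_pow_of_charFacts`** — for `W/ℚ` elliptic, `p` odd, `Φ₀ ≤ W[p]` a
  rational line, EVEN, with NON-TRIVIAL action (`hnt`, the line datum bsd-addord's counts already
  carry), `Σ₀ ∌ p` with good reduction off `Σ₀ ∪ {p}`: granted the two twisted character facts, and two per-pair
  ANALYTIC certificates `hCcert : ord_T(L_{Σ₀}(C ⊗ χ, T) mod p) = a`,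
  `hDcert : ord_T(L_{Σ₀}(D ⊗ χ, T) mod p) = b` (instrument data: generalized Bernoulli numbers of the
  characters of `Φ₀` and `W[p]/Φ₀`; stated for EVERY primitive Dirichlet character acting as `Φ₀`'s,
  resp. the quotient's, character — there is exactly one — and every `g ∈ Λ` with the interpolation
  property — `g` is unique), for every cyclotomic `κ`:
  `p^{a + b} = #residualLineH1 W p κ Σ₀ Φ₀ · #residualQuotSelmer W p κ Σ₀ Φ₀`.
* §3 **`X3Branch.eval_of_charFacts_of_certs`** — the displayed `hn` of the certificate road in its
  exact shape (`p^{n + Σδ} = …`) from `a + b = n + Σ_{v∈Σ₀} δ_v(W)`.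

Consequence (sequel `X3BranchCertificateRoadOfCharacterFacts.lean`): on the NON-degenerate X3 rows
((M) every odd `p`; (G-ord, `e = 2`) as an `hGV`-free road) the per-pair inputs are PUBLISHED records
+ the line datum + THREE instrument certificates (`hcert`, `hCcert`, `hDcert`); no residual-count
evaluation is displayed any more. The DEGENERATE rows (`φ = 1`, `ψ = ω`) are NOT covered (GV p. 5:
"we can prove very little"; their counts are class-field theory of `ℚ_∞`, not a character
`L`-function).

References: [GreenbergVatsal2000] §2 pp. 28–30 (display (16), Props. (2.6), (2.8), Cor. (2.3)),
§3 pp. 41–43; [Greenberg2001PastPresent] §6 p. 367; [SilvermanAEC2009] VII.4.1, III.8;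
[SilvermanCSS1997] Ch. II §7–§8; [Washington1997] Ch. 3.
-/

set_option autoImplicit false

noncomputable section

open scoped Classical

namespace Summit.BirchSwinnertonDyer.Rank1Residual.Additive

open NumberField IsDedekindDomain Field Rat.HeightOneSpectrum WeierstrassCurve
  Literature.NumberTheory.GaloisRepresentations Literature.NumberTheory.EllipticCurves
  Literature.NumberTheory.EllipticCurves.GreenbergVatsal2000
  Literature.NumberTheory.EllipticCurves.Rank1Residual
  Summit.BirchSwinnertonDyer.Rank1Residual.X2.ResidualDevissageModules
  Summit.BirchSwinnertonDyer.Rank1Residual.X2.ResidualDevissageLine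
  Summit.BirchSwinnertonDyer.Rank1Residual.X2.PrimeOrderCharacters
  Summit.BirchSwinnertonDyer.Rank1Residual.X2.ResidualLineCharacters

/-! ### §1 Conductor support of `ψ` without `p ∤ d`; `φ ≠ 1`; `ψ ≠ ω` -/

section Characters

variable {W : WeierstrassCurve ℚ} [W.IsElliptic] {p : ℕ} [hp : Fact p.Prime]
  {Φ₀ : AddSubgroup (geomTorsion W (p : ℤ))} (hΦ : IsRationalLine W p Φ₀)

include hΦ in
/-- **The primes `ℓ ≠ p` of the conductor of `ψ` lie in `Σ₀`** (Néron–Ogg–Shafarevich on the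
quotient `W[p]/Φ₀`; X2's `exists_mem_of_dvd_level_quot` with its hypothesis `p ∤ d` replaced by
`ℓ ≠ p`, which is all its proof uses). [cite: SilvermanAEC2009, VII.4.1] -/
theorem X3Branch.exists_mem_of_dvd_level_quot_of_ne {S₀ : Finset (HeightOneSpectrum (𝓞 ℚ))}
    (hS : ∀ v : HeightOneSpectrum (𝓞 ℚ), v ∉ S₀ → ((p : ℕ) : 𝓞 ℚ) ∉ v.asIdeal →
      W.HasGoodReductionAt v)
    {d : ℕ} [NeZero d] {ψ : DirichletCharacter (ZMod p) d} (hψprim : ψ.IsPrimitive)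
    (hψ : ∀ (σ : absoluteGaloisGroup ℚ) (y : (lineSub Φ₀ hΦ).Quot),
      σ • y = (ψ ((modNCyclotomicCharacter ℚ d σ : (ZMod d)ˣ) : ZMod d)).val • y)
    {ℓ : ℕ} (hℓ : ℓ.Prime) (hℓd : ℓ ∣ d) (hℓp : ℓ ≠ p) :
    ∃ v ∈ S₀, ((ℓ : ℕ) : 𝓞 ℚ) ∈ v.asIdeal := by
  have hpr : p.Prime := hp.out
  obtain ⟨v, hv⟩ :=
    Literature.NumberTheory.NumberFields.RingOfIntegers.exists_heightOneSpectrum_natCast_mem ℚ hℓ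
  by_cases hvS : v ∈ S₀
  · exact ⟨v, hvS, hv⟩
  exfalso
  have hpv : ((p : ℕ) : 𝓞 ℚ) ∉ v.asIdeal := fun h ↦ hℓp <| by
    rw [← natGenerator_eq_of_natCast_mem_asIdeal hℓ hv, natGenerator_eq_of_natCast_mem_asIdeal hpr h]
  have hgood := hS v hvS hpv
  have hχ : ∀ (σ : absoluteGaloisGroup ℚ) (y : (lineSub Φ₀ hΦ).Quot),
      σ • y = ((ψ.toUnitHom.comp (modNCyclotomicCharacter ℚ d) σ : (ZMod p)ˣ) : ZMod p).val • y :=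
    fun σ y ↦ by rw [coe_toUnitHom_comp, hψ]
  refine not_dvd_level_of_isPrimitive_of_forall_mem_inertia hψprim hℓ hv
    (adicCompletionPrime_mem_primesAbove ℚ v) (fun τ hτ ↦ ?_) hℓd
  have hfix : ∀ P : geomTorsion W (p : ℤ), τ • P = P := fun P ↦
    W.smul_geomTorsion_eq_of_mem_inertia hgood (n := (p : ℤ)) (by rw [Int.cast_natCast]; exact hpv)
      (adicCompletionPrime_mem_primesAbove ℚ v) hτ P
  have h1 := character_eq_intCast_of_forall_smul_eq (natCard_quot_eq hΦ) hχ (σ := τ) (a := 1)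
    (fun y ↦ by rw [one_zsmul]; exact smul_quot_eq_self_of_forall hΦ hfix y)
  rw [coe_toUnitHom_comp, Int.cast_one] at h1
  exact h1

omit hp in
/-- **Compatibility of the cyclotomic characters: `χ_M(σ) ≡ χ_n(σ) (mod n)` for `n ∣ M`** (read on a
primitive `M`-th root of unity `ζ` and the primitive `n`-th root `ζ^{M/n}`). [folklore] -/
theorem X3Branch.natCast_val_modNCyclotomicCharacter_of_dvd {n M : ℕ} [NeZero n] [NeZero M]
    (hnM : n ∣ M) (σ : absoluteGaloisGroup ℚ) :
    (((modNCyclotomicCharacter ℚ M σ : (ZMod M)ˣ) : ZMod M).val : ZMod n) =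
      ((modNCyclotomicCharacter ℚ n σ : (ZMod n)ˣ) : ZMod n) := by
  obtain ⟨ζ, hζ⟩ := HasEnoughRootsOfUnity.exists_primitiveRoot (AlgebraicClosure ℚ) M
  obtain ⟨k, hk⟩ := hnM
  have hn0 : 0 < n := Nat.pos_of_ne_zero (NeZero.ne n)
  have hζ' : IsPrimitiveRoot (ζ ^ k) n := hζ.pow (Nat.pos_of_ne_zero (NeZero.ne M)) (by rw [hk, mul_comm])
  symm
  refine modNCyclotomicCharacter_eq_of_smul_eq_pow ℚ n hζ' σ ?_
  rw [smul_pow', modNCyclotomicCharacter_spec ℚ M σ ζ hζ.pow_eq_one, ← pow_mul, ← pow_mul, mul_comm]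

omit [W.IsElliptic] in
/-- **`φ ≠ 1`** when some point of `Φ₀` is moved by some `σ ∈ Γ_ℚ` (GV p. 29: "Assuming that `ξ` is
nontrivial"; on the X3 rows: the NON-degenerate lines). [cite: GreenbergVatsal2000, §2 p. 29] -/
theorem X3Branch.character_sub_ne_one_of_exists_smul_ne
    (hnt : ∃ (σ : absoluteGaloisGroup ℚ) (P : geomTorsion W (p : ℤ)), P ∈ Φ₀ ∧ σ • P ≠ P)
    {m : ℕ} [NeZero m] {φ : DirichletCharacter (ZMod p) m}
    (hφ0 : ∀ (σ : absoluteGaloisGroup ℚ), ∀ P ∈ Φ₀,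
      σ • P = (φ ((modNCyclotomicCharacter ℚ m σ : (ZMod m)ˣ) : ZMod m)).val • P) :
    φ ≠ 1 := by
  have hpr : p.Prime := hp.out
  rintro rfl
  obtain ⟨σ, P, hP, hne⟩ := hnt
  apply hne
  have h := hφ0 σ P hP
  rwa [MulChar.one_apply_coe, ZMod.val_one'' hpr.ne_one, one_nsmul] at h

include hΦ in
/-- **`φ · ψ = χ_p` on `W[p]`** (`det ρ̄_{E,p} = χ_p`, GV p. 28: "`φψ = ω`, the Teichmüller
character"): if `σ` acts on the rational line `Φ₀` as the scalar `a` and on `W[p]/Φ₀` as `b`, then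
`a·b ≡ χ_p(σ) (mod p)` — read on the Weil pairing `ζ = e_p(S, P₁)` (`P₁ ∈ Φ₀`, `ζ ≠ 1` by
non-degeneracy): `σζ = e_p(σS, σP₁) = ζ^{ab}` (bilinear, alternating on `Φ₀ = ℤP₁`) and
`σζ = ζ^{χ_p(σ)}`. [cite: GreenbergVatsal2000, §2 p. 28] [cite: SilvermanCSS1997, Ch. II §7 Proposition and §8] -/
theorem X3Branch.natCast_mul_eq_modNCyclotomicCharacter_of_line {σ : absoluteGaloisGroup ℚ} {a b : ℕ}
    (ha : ∀ P ∈ Φ₀, σ • P = a • P) (hb : ∀ P : geomTorsion W (p : ℤ), σ • P - b • P ∈ Φ₀) :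
    ((a : ZMod p) * b) = ((modNCyclotomicCharacter ℚ p σ : (ZMod p)ˣ) : ZMod p) := by
  have hpr : p.Prime := hp.out
  obtain ⟨w, hpow, haddl, haddr, halt, hnd, hgal⟩ :=
    W.exists_weilPairing_holds p hpr.two_le (by exact_mod_cast hpr.ne_zero)
  -- elementary consequences of bilinearity
  have hne0 : ∀ S T, w S T ≠ 0 := fun S T h0 ↦ by
    have := hpow S T
    rw [h0, zero_pow hpr.ne_zero] at this
    exact zero_ne_one this
  have hzero_left : ∀ T, w 0 T = 1 := fun T ↦ by
    have h := haddl 0 0 T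
    rw [add_zero] at h
    exact (mul_eq_left₀ (hne0 0 T)).mp h.symm
  have hzero_right : ∀ S, w S 0 = 1 := fun S ↦ by
    have h := haddr S 0 0
    rw [add_zero] at h
    exact (mul_eq_left₀ (hne0 S 0)).mp h.symm
  have hnsmul_left : ∀ (n : ℕ) S T, w (n • S) T = w S T ^ n := fun n S T ↦ by
    induction n with
    | zero => rw [zero_nsmul, pow_zero, hzero_left]
    | succ n ih => rw [succ_nsmul, haddl, ih, pow_succ]
  have hnsmul_right : ∀ (n : ℕ) S T, w S (n • T) = w S T ^ n := fun n S T ↦ by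
    induction n with
    | zero => rw [zero_nsmul, pow_zero, hzero_right]
    | succ n ih => rw [succ_nsmul, haddr, ih, pow_succ]
  -- a non-zero point `P₁` of `Φ₀`; `Φ₀ = ℤP₁`
  haveI : Finite Φ₀ := Nat.finite_of_card_ne_zero (by rw [hΦ.1]; exact hpr.ne_zero)
  haveI : Nontrivial Φ₀ := Finite.one_lt_card_iff_nontrivial.mp (by rw [hΦ.1]; exact hpr.one_lt)
  obtain ⟨⟨P₁, hP₁⟩, hP₁ne⟩ := exists_ne (0 : Φ₀)
  have hP₁0 : P₁ ≠ 0 := fun h ↦ hP₁ne (Subtype.ext h)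
  have hord : addOrderOf P₁ = p := addOrderOf_eq_prime (nsmul_eq_zero_of_mem_geomTorsion P₁) hP₁0
  have heq : AddSubgroup.zmultiples P₁ = Φ₀ :=
    AddSubgroup.eq_of_le_of_card_ge (AddSubgroup.zmultiples_le.mpr hP₁)
      (by rw [hΦ.1, Nat.card_zmultiples, hord])
  have hfin : IsOfFinAddOrder P₁ := addOrderOf_pos_iff.mp (by rw [hord]; exact hpr.pos)
  have hmulti : ∀ Q ∈ Φ₀, ∃ n : ℕ, n • P₁ = Q := fun Q hQ ↦ by
    rw [← heq, ← hfin.mem_multiples_iff_mem_zmultiples, AddSubmonoid.mem_multiples_iff] at hQ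
    exact hQ
  have halt' : ∀ Q ∈ Φ₀, w Q P₁ = 1 := fun Q hQ ↦ by
    obtain ⟨n, rfl⟩ := hmulti Q hQ
    rw [hnsmul_left, halt, one_pow]
  -- non-degeneracy: `ζ = w S P₁ ≠ 1` for some `S`
  obtain ⟨S, hS⟩ : ∃ S, w S P₁ ≠ 1 := by
    by_contra h
    push Not at h
    exact hP₁0 (hnd P₁ h)
  set ζ := w S P₁ with hζ
  have hζp : ζ ^ p = 1 := hpow S P₁
  have hordζ : orderOf ζ = p := orderOf_eq_prime hζp hS
  have hfinζ : IsOfFinOrder ζ := orderOf_pos_iff.mp (by rw [hordζ]; exact hpr.pos)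
  -- `σζ = w (σS) (σP₁) = ζ^{b a}`
  have h1 : σ • ζ = ζ ^ (b * a) := by
    rw [hζ, hgal σ S P₁, ha P₁ hP₁, hnsmul_right]
    have hdec : σ • S = b • S + (σ • S - b • S) := by abel
    rw [hdec, haddl, halt' _ (hb S), mul_one, hnsmul_left, ← pow_mul]
  -- `σζ = ζ^{χ_p(σ)}`
  have h2 : σ • ζ = ζ ^ ((modNCyclotomicCharacter ℚ p σ : (ZMod p)ˣ) : ZMod p).val :=
    modNCyclotomicCharacter_spec ℚ p σ ζ hζp
  rw [h1, hfinζ.pow_eq_pow_iff_modEq, hordζ] at h2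
  have h3 := (ZMod.natCast_eq_natCast_iff' _ _ _).mpr h2
  rw [Nat.cast_mul, ZMod.natCast_zmod_val, mul_comm] at h3
  exact h3

include hΦ in
/-- **`ψ ≠ ω` on a line with NON-TRIVIAL action** (`φ ≠ 1`, and `φψ = ω`): some integer `c` prime to
`dp` has `ψ(c) ≢ c (mod p)` — the hypothesis "`ψ ≠ ω`" of
`characterLFunctionD_hasUnitContent_and_order_eq_card_of_ne_teichmuller` (GV p. 29: "since
`ψ = ωφ⁻¹`, we have `ψ ≠ ω`"; on the X3 rows: the NON-degenerate lines). Witness: `c = χ_{dp}(σ)` for a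
`σ` moving a point of `Φ₀`. [cite: GreenbergVatsal2000, §2 pp. 28–29] -/
theorem X3Branch.exists_coprime_apply_ne_of_exists_smul_ne
    (hnt : ∃ (σ : absoluteGaloisGroup ℚ) (P : geomTorsion W (p : ℤ)), P ∈ Φ₀ ∧ σ • P ≠ P)
    {m : ℕ} [NeZero m] {φ : DirichletCharacter (ZMod p) m}
    (hφ0 : ∀ (σ : absoluteGaloisGroup ℚ), ∀ P ∈ Φ₀,
      σ • P = (φ ((modNCyclotomicCharacter ℚ m σ : (ZMod m)ˣ) : ZMod m)).val • P)
    {d : ℕ} [NeZero d] {ψ : DirichletCharacter (ZMod p) d}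
    (hψ0 : ∀ (σ : absoluteGaloisGroup ℚ) (P : geomTorsion W (p : ℤ)),
      σ • P - (ψ ((modNCyclotomicCharacter ℚ d σ : (ZMod d)ˣ) : ZMod d)).val • P ∈ Φ₀) :
    ∃ c : ℕ, c.Coprime (d * p) ∧ ψ (c : ZMod d) ≠ (c : ZMod p) := by
  have hpr : p.Prime := hp.out
  obtain ⟨σ, P, hP, hne⟩ := hnt
  haveI : NeZero (d * p) := ⟨mul_ne_zero (NeZero.ne d) hpr.ne_zero⟩
  set u : (ZMod (d * p))ˣ := modNCyclotomicCharacter ℚ (d * p) σ with hu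
  refine ⟨(u : ZMod (d * p)).val, ZMod.val_coe_unit_coprime u, ?_⟩
  rw [hu, X3Branch.natCast_val_modNCyclotomicCharacter_of_dvd (dvd_mul_right d p) σ,
    X3Branch.natCast_val_modNCyclotomicCharacter_of_dvd (dvd_mul_left p d) σ]
  intro heq
  -- `φ(σ) ψ(σ) = χ_p(σ) = ψ(σ)`, so `φ(σ) = 1` and `σ` fixes `Φ₀` pointwise
  have hdet := X3Branch.natCast_mul_eq_modNCyclotomicCharacter_of_line hΦ (hφ0 σ) (hψ0 σ)
  rw [ZMod.natCast_zmod_val, ZMod.natCast_zmod_val, ← heq] at hdet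
  have hψu : ψ ((modNCyclotomicCharacter ℚ d σ : (ZMod d)ˣ) : ZMod d) ≠ 0 :=
    (IsUnit.map ψ (modNCyclotomicCharacter ℚ d σ).isUnit).ne_zero
  have hφ1 : φ ((modNCyclotomicCharacter ℚ m σ : (ZMod m)ˣ) : ZMod m) = 1 :=
    (mul_eq_right₀ hψu).mp hdet
  apply hne
  rw [hφ0 σ P hP, hφ1, ZMod.val_one'' hpr.ne_one, one_nsmul]

end Characters

/-! ### §2 The residual count from the twisted character facts + two `λ`-certificates -/

section Count

variable {W : WeierstrassCurve ℚ} [W.IsElliptic] {p : ℕ} [hp : Fact p.Prime]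

/-- **GV's residual count EVALUATED from the character facts at a twist** — for `W/ℚ` elliptic, `p`
odd, `κ` cyclotomic, `Φ₀ ≤ W[p]` a rational line that is EVEN (`φ` even, `ψ` odd), with NON-TRIVIAL
action (`φ ≠ 1`, hence `ψ ≠ ω` by `φψ = ω`), `Σ₀ ∌ p` outside which (away from `p`) `W` has
good reduction (so the conductors of `φ`, `ψ` are supported on `Σ₀ ∪ {p}`): granted the two sentences
of GV pp. 41–42 at a twist (`hC`, `hD`: Ferrero–Washington, Mazur–Wiles for any abelian field, Props.
(2.6)/(2.8)) and two ANALYTIC certificates — `hCcert`: the `𝔽_p⟦T⟧`-order of `L_{Σ₀}(C ⊗ χ, T) mod p`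
is `a`, `hDcert`: that of `L_{Σ₀}(D ⊗ χ, T) mod p` is `b` (instrument data on the generalized
Bernoulli numbers of the characters of `Φ₀` and `W[p]/Φ₀`) —
`p^{a+b} = #H¹(ℚ_Σ/ℚ_∞, Φ₀) · #U(W[p]/Φ₀)`. The characters are produced in the kernel
(Kronecker–Weber, X2's `exists_character_sub/_quot`), their parity from `LineEven`, the existence of
the interpolating elements of `Λ` is the tree's Kubota–Leopoldt–Iwasawa theorem.
[cite: GreenbergVatsal2000, §2 pp. 28–29 (Props. (2.6), (2.8)) and §3 pp. 41–43] -/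
theorem X3Branch.residualCount_eq_pow_of_charFacts
    (hC : characterLFunctionC_hasUnitContent_and_order_eq_card_of_ne_one)
    (hD : characterLFunctionD_hasUnitContent_and_order_eq_card_of_ne_teichmuller)
    (hp2 : p ≠ 2) (S₀ : Finset (HeightOneSpectrum (𝓞 ℚ)))
    (hS₀ : ∀ v ∈ S₀, ((p : ℕ) : 𝓞 ℚ) ∉ v.asIdeal)
    (hS : ∀ v : HeightOneSpectrum (𝓞 ℚ), v ∉ S₀ → ((p : ℕ) : 𝓞 ℚ) ∉ v.asIdeal →
      W.HasGoodReductionAt v)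
    (Φ₀ : AddSubgroup (geomTorsion W (p : ℤ))) (hΦ : IsRationalLine W p Φ₀)
    (heven : LineEven W p Φ₀)
    (hnt : ∃ (σ : absoluteGaloisGroup ℚ) (P : geomTorsion W (p : ℤ)), P ∈ Φ₀ ∧ σ • P ≠ P)
    {a b : ℕ}
    (hCcert : ∀ (m : ℕ) [NeZero m] (φ : DirichletCharacter (ZMod p) m), φ.IsPrimitive →
      (∀ (σ : absoluteGaloisGroup ℚ), ∀ P ∈ Φ₀,
        σ • P = (φ ((modNCyclotomicCharacter ℚ m σ : (ZMod m)ˣ) : ZMod m)).val • P) →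
      ∀ g : IwasawaAlgebra p, IsCharacterLFunctionC p φ S₀ g →
        (PowerSeries.map (PadicInt.toZMod (p := p)) g).order.toNat = a)
    (hDcert : ∀ (d : ℕ) [NeZero d] (ψ : DirichletCharacter (ZMod p) d), ψ.IsPrimitive →
      (∀ (σ : absoluteGaloisGroup ℚ) (P : geomTorsion W (p : ℤ)),
        σ • P - (ψ ((modNCyclotomicCharacter ℚ d σ : (ZMod d)ˣ) : ZMod d)).val • P ∈ Φ₀) →
      ∀ g : IwasawaAlgebra p, IsCharacterLFunctionD p ψ S₀ g →
        (PowerSeries.map (PadicInt.toZMod (p := p)) g).order.toNat = b)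
    (κ : ZpExtension ℚ p) (hκ : κ.IsCyclotomic) :
    p ^ (a + b) =
      Nat.card (residualLineH1 W p κ S₀ Φ₀ hΦ) * Nat.card (residualQuotSelmer W p κ S₀ Φ₀ hΦ) := by
  -- the characters of `Φ₀` and `W[p]/Φ₀` (Kronecker–Weber), parity, non-triviality, conductors
  obtain ⟨m, _, φ, hφprim, hφA, hφ0⟩ := exists_character_sub hΦ
  obtain ⟨d, _, ψ, hψprim, hψQ, hψ0⟩ := exists_character_quot hΦ
  have hφeven : φ.Even := even_of_lineEven hΦ heven hφA
  have hψodd : ψ.Odd := odd_of_lineEven hΦ hp2 heven hψQ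
  have hφ1 : φ ≠ 1 := X3Branch.character_sub_ne_one_of_exists_smul_ne hnt hφ0
  have hψω : ∃ c : ℕ, c.Coprime (d * p) ∧ ψ (c : ZMod d) ≠ (c : ZMod p) :=
    X3Branch.exists_coprime_apply_ne_of_exists_smul_ne hΦ hnt hφ0 hψ0
  have hSm : ∀ ℓ : ℕ, ℓ.Prime → ℓ ∣ m → ℓ ≠ p → ∃ v ∈ S₀, ((ℓ : ℕ) : 𝓞 ℚ) ∈ v.asIdeal :=
    fun ℓ hℓ hℓm hℓp ↦ exists_mem_of_dvd_level_sub hΦ hS hφprim hφA hℓ hℓm hℓp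
  have hSd : ∀ ℓ : ℕ, ℓ.Prime → ℓ ∣ d → ℓ ≠ p → ∃ v ∈ S₀, ((ℓ : ℕ) : 𝓞 ℚ) ∈ v.asIdeal :=
    fun ℓ hℓ hℓd hℓp ↦ X3Branch.exists_mem_of_dvd_level_quot_of_ne hΦ hS hψprim hψQ hℓ hℓd hℓp
  -- the character `p`-adic `L`-functions (Kubota–Leopoldt–Iwasawa, proved)
  obtain ⟨gC, hgC⟩ := exists_isCharacterLFunctionC_of_ne_one p φ S₀ hp2 hφ1
  obtain ⟨gD, hgD⟩ := exists_isCharacterLFunctionD_of_exists_ne p ψ S₀ hp2 hψω hS₀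
  -- the character identities at the twist
  obtain ⟨-, hCcard⟩ := hC p κ m φ S₀ (lineSub Φ₀ hΦ).Sub hp2 hφprim hφeven hφ1 hκ hS₀ hSm
    (natCard_sub_eq hΦ) hφA gC hgC
  obtain ⟨-, hDcard⟩ := hD p κ d ψ S₀ (lineSub Φ₀ hΦ).Quot hp2 hψprim hψodd hψω hκ hS₀ hSd
    (natCard_quot_eq hΦ) hψQ gD hgD
  -- the certificates
  rw [hCcert m φ hφprim hφ0 gC hgC] at hCcard
  rw [hDcert d ψ hψprim hψ0 gD hgD] at hDcard
  change p ^ (a + b) =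
    Nat.card (unramifiedOutside κ.kerSubgroup (lineSub Φ₀ hΦ).Sub p
        (↑S₀ : Set (HeightOneSpectrum (𝓞 ℚ)))) *
      Nat.card (unramifiedSelmer κ.kerSubgroup (lineSub Φ₀ hΦ).Quot p
        (↑S₀ : Set (HeightOneSpectrum (𝓞 ℚ))))
  rw [pow_add, hCcard, hDcard]

end Count

/-! ### §3 The displayed `hn` of the certificate road -/

section Eval

variable {W : WeierstrassCurve ℚ} [W.IsElliptic] {p : ℕ} [hp : Fact p.Prime]

/-- **The evaluation `hn : p^{n + Σ_{v∈Σ₀} δ_v(W)} = #H¹ · #U` of `X3BranchCertificateRoad.lean` §3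
from the character facts at a twist and the two `λ`-certificates**, given the bookkeeping identity
`a + b = n + Σ_{v∈Σ₀} δ_v(W)` between the certified analytic orders and the index `n` of the
unit-coefficient certificate (GV p. 43: "the `λ`-invariant of `L(G, χ, T)` is equal to
`λ_{χφ,Σ₀} + λ_{χψ,Σ₀}`"). [cite: GreenbergVatsal2000, §3 p. 43 and §2 Cor. (2.3), Prop. (2.4)] -/
theorem X3Branch.eval_of_charFacts_of_certs
    (hC : characterLFunctionC_hasUnitContent_and_order_eq_card_of_ne_one)
    (hD : characterLFunctionD_hasUnitContent_and_order_eq_card_of_ne_teichmuller)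
    (hp2 : p ≠ 2) (S₀ : Finset (HeightOneSpectrum (𝓞 ℚ)))
    (hS₀ : ∀ v ∈ S₀, ((p : ℕ) : 𝓞 ℚ) ∉ v.asIdeal)
    (hS : ∀ v : HeightOneSpectrum (𝓞 ℚ), v ∉ S₀ → ((p : ℕ) : 𝓞 ℚ) ∉ v.asIdeal →
      W.HasGoodReductionAt v)
    (Φ₀ : AddSubgroup (geomTorsion W (p : ℤ))) (hΦ : IsRationalLine W p Φ₀)
    (heven : LineEven W p Φ₀)
    (hnt : ∃ (σ : absoluteGaloisGroup ℚ) (P : geomTorsion W (p : ℤ)), P ∈ Φ₀ ∧ σ • P ≠ P)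
    {a b n : ℕ} (hab : a + b = n + ∑ v ∈ S₀, delta W p v)
    (hCcert : ∀ (m : ℕ) [NeZero m] (φ : DirichletCharacter (ZMod p) m), φ.IsPrimitive →
      (∀ (σ : absoluteGaloisGroup ℚ), ∀ P ∈ Φ₀,
        σ • P = (φ ((modNCyclotomicCharacter ℚ m σ : (ZMod m)ˣ) : ZMod m)).val • P) →
      ∀ g : IwasawaAlgebra p, IsCharacterLFunctionC p φ S₀ g →
        (PowerSeries.map (PadicInt.toZMod (p := p)) g).order.toNat = a)
    (hDcert : ∀ (d : ℕ) [NeZero d] (ψ : DirichletCharacter (ZMod p) d), ψ.IsPrimitive →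
      (∀ (σ : absoluteGaloisGroup ℚ) (P : geomTorsion W (p : ℤ)),
        σ • P - (ψ ((modNCyclotomicCharacter ℚ d σ : (ZMod d)ˣ) : ZMod d)).val • P ∈ Φ₀) →
      ∀ g : IwasawaAlgebra p, IsCharacterLFunctionD p ψ S₀ g →
        (PowerSeries.map (PadicInt.toZMod (p := p)) g).order.toNat = b)
    (κ : ZpExtension ℚ p) (hκ : κ.IsCyclotomic) :
    p ^ (n + ∑ v ∈ S₀, delta W p v) =
      Nat.card (residualLineH1 W p κ S₀ Φ₀ hΦ) * Nat.card (residualQuotSelmer W p κ S₀ Φ₀ hΦ) := by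
  rw [← hab]
  exact X3Branch.residualCount_eq_pow_of_charFacts hC hD hp2 S₀ hS₀ hS Φ₀ hΦ heven hnt hCcert hDcert
    κ hκ

end Eval

end Summit.BirchSwinnertonDyer.Rank1Residual.Additive

end
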